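/-
Copyright (c) 2026 the pub-hodgecm-mathlib formalisation cell (harness21).  Prover seat hodgecm-mathlib-K2E3-p03 (g7), HCML Track B «K2-LIT» ∕ h413
(`stmt-HodgeConjecture-24833`), leaf (nsc-S-A′), the «(T)-programme for D94», file F6: THE `θ`-TWIST OF A SMOOTH IRREDUCIBLE REPRESENTATION OF `GL₃(F)` AND ITS
BOREL EXPONENT TABLE (the shell of NYA := T(NAA), and of every «weight-profile» statement about irreducible admissibles).  2026-09-04.
-/
import Summits.HodgeConjecture.HodgeConjecture.Theorems.K2E3JacquetWeightTransport      -- ★ part 1: `finrank_weightSpace_eq_of_gkAutomorphism`, `tch_comp_leviAut_gkAutomorphism`, `leviAut_leviAut`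
import Literature.NumberTheory.Automorphic.IrreducibleClasses                          -- ★ `SmoothIrrep`
import Literature.NumberTheory.Automorphic.ParabolicInductionAdmissibleProofs          -- ★ `isIrreducible_comp_of_surjective`
import Literature.NumberTheory.Automorphic.ParabolicGLReindex                          -- ★ `IsSmooth.comp_of_continuous`
import HarnessLib

/-!
# K2_E3 road (h413), leaf (nsc-S-A′) — the `θ`-twist `r ∘ θ` of a smooth irreducible `r` of `GL₃(F)` (`θ = gkAutomorphism`) and its Borel exponents

Cell `pub/hodgecm-mathlib` (D-0151), Track B, seat K2E3-p03 (g7); `--supports stmt-HodgeConjecture-24833 --as helper`; THEOREMS ONLY (no `def`, no instance, no notation,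
no named fact, no `sorry`); never imports `Cruxes/…/Lines`.  COUNT-NEUTRAL generic helper of the «(T)-programme» (R0 13:43Z, K2E3-p17 (g9) «=» 13:46Z).

THE MATHEMATICS ([BernsteinZelevinsky1976, §2.21–2.25]; [Zelevinsky1980, §1.1]).  For a smooth irreducible `r` of `GL₃(F)` on `V` and the continuous involution
`θ(g) = w₀ ᵗg⁻¹ w₀`, the twist `r′ := r ∘ θ` on the SAME space is smooth irreducible, and `id_V` is `θ`-equivariant from `r` to `r′` (`r(g) = r′(θ g)` as `θθ = 1`).
Hence (★ part 1) **`mult_{r_B r}(ζ) = mult_{r_B r′}(ζ ∘ θ_T)`** and **`mult_{r_B r′}(ζ) = mult_{r_B r}(ζ ∘ θ_T)`** (`θ_T` an involution), in `tch` letters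
**`mult_{r′}(tch(p,q,s)) = mult_r(tch(s⁻¹,q⁻¹,p⁻¹))`**; `r_B r′` is finite-dimensional iff `r_B r` is; `r′` is admissible iff `r` is.  So a statement «no irreducible
admissible `ω` has weight profile `E`» is equivalent to the same statement for the reversed-inverted profile `E ∘ θ_T` — e.g. NYA(a) «no `ω` with `E(ω) = {(aν,a,aν)}`»
⟺ NAA(b) «no `ω` with `E(ω) = {(b,bν,b)}`», `b = (aν)⁻¹` — one real (Q-side) proof for the pair.  No `def`: the twist is delivered as `∃ r′ Φ, …` with `Φ`'s equivariance.

HONEST LABEL: HC_CM is proved only modulo the 7 printed citations (2 remaining named inputs: hLiu418 = stmt-HodgeConjecture-24832, h413 = stmt-HodgeConjecture-24833) until rung 0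
closes; count-neutral generic helper.

## Mathlib ∕ tree search
★ `SmoothIrrep` (Literature `IrreducibleClasses`); ★ `isIrreducible_comp_of_surjective` (ParabolicInductionAdmissibleProofs), ★ `IsSmooth.comp_of_continuous` (ParabolicGLReindex),
★ `IsAdmissible.of_equivariant_equiv` (SmoothIndTransport); ★ part 1 `finrank_weightSpace_eq_of_gkAutomorphism`, `tch_comp_leviAut_gkAutomorphism`, `leviAut_leviAut`;
★ E4b-T `map_coinvariantsKer_eq`, `gkAutomorphism_mem_borel_iff`; ★ T1 `gkAutomorphism_gkAutomorphism`.  Dedup: `rg "IrrepTransport|exists_gkTwist|_gkTwist"` — none.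

## References
* [BernsteinZelevinsky1976] I. N. Bernstein, A. V. Zelevinsky, *Representations of the group GL(n,F) where F is a non-archimedean local field*, Russian Math. Surveys 31 (1976), §2.21–2.25.
* [Zelevinsky1980] A. V. Zelevinsky, *Induced representations of reductive p-adic groups II*, Ann. Sci. ÉNS 13 (1980), §1.1.
-/

set_option autoImplicit false
set_option linter.dupNamespace false

noncomputable section

open Function Representation Module Module.End
open scoped MatrixGroups
open Literature.NumberTheory.Automorphic
open Summit.HodgeConjecture.HodgeConjecture.Cruxes.H413.K2E3GL3OuterAutomorphismInduction
open Summit.HodgeConjecture.HodgeConjecture.Cruxes.H413.K2E3JacquetModuleAutomorphismTransport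
open Summit.HodgeConjecture.HodgeConjecture.Cruxes.H413.K2E3JacquetWeightTransport

namespace Summit.HodgeConjecture.HodgeConjecture.Cruxes.H413.K2E3GL3IrrepTransport

variable {F : Type} [Field F] [ValuativeRel F] [TopologicalSpace F] [IsNonarchimedeanLocalField F]

/-- **THE `θ`-TWIST EXISTS**: for every smooth irreducible `r` of `GL₃(F)` there are a smooth irreducible `r′` and a linear isomorphism `Φ : V_r ≃ V_{r′}` with
`Φ (r g v) = r′ (θ g) (Φ v)` (`r′ = r ∘ θ` on the same space, `Φ = id`, `θθ = 1`). [cite: BernsteinZelevinsky1976, §2.21] [cite: Zelevinsky1980, §1.1] -/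
theorem exists_gkTwist (r : SmoothIrrep (GL (Fin 3) F)) :
    ∃ (r' : SmoothIrrep (GL (Fin 3) F)) (Φ : r.V ≃ₗ[ℂ] r'.V), ∀ (g : GL (Fin 3) F) (v : r.V), Φ (r.ρ g v) = r'.ρ (gkAutomorphism g) (Φ v) := by
  haveI : IsTopologicalRing F := inferInstance
  haveI := r.isIrreducible
  refine ⟨{ V := r.V, ρ := r.ρ.comp (gkAutomorphism : GL (Fin 3) F ≃ₜ* GL (Fin 3) F).toMulEquiv.toMonoidHom,
            isIrreducible := isIrreducible_comp_of_surjective r.ρ _ (gkAutomorphism : GL (Fin 3) F ≃ₜ* GL (Fin 3) F).surjective,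
            isSmooth := IsSmooth.comp_of_continuous r.ρ _ (gkAutomorphism : GL (Fin 3) F ≃ₜ* GL (Fin 3) F).continuous r.isSmooth },
    LinearEquiv.refl ℂ r.V, fun g v => ?_⟩
  change r.ρ g v = r.ρ (gkAutomorphism (gkAutomorphism g)) v
  rw [gkAutomorphism_gkAutomorphism]

section Twist

variable {r r' : SmoothIrrep (GL (Fin 3) F)} (Φ : r.V ≃ₗ[ℂ] r'.V) (hΦ : ∀ (g : GL (Fin 3) F) (v : r.V), Φ (r.ρ g v) = r'.ρ (gkAutomorphism g) (Φ v))
include hΦ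

/-- The inverse equivariance `Φ⁻¹ (r′ g w) = r (θ g) (Φ⁻¹ w)` (`θ⁻¹ = θ`). [cite: Zelevinsky1980, §1.1] -/
theorem symm_equivariant : ∀ (g : GL (Fin 3) F) (w : r'.V), Φ.symm (r'.ρ g w) = r.ρ (gkAutomorphism g) (Φ.symm w) := by
  intro g w
  have h := symm_apply_of_equivariant (gkAutomorphism : GL (Fin 3) F ≃ₜ* GL (Fin 3) F).toMulEquiv Φ hΦ g w
  have hs : (gkAutomorphism : GL (Fin 3) F ≃ₜ* GL (Fin 3) F).toMulEquiv.symm g = gkAutomorphism g := by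
    rw [MulEquiv.symm_apply_eq]
    exact (gkAutomorphism_gkAutomorphism F g).symm
  rw [hs] at h
  exact h

/-- **`mult_{r_B r}(ζ) = mult_{r_B r′}(ζ ∘ θ_T)`** (★ part 1). [cite: BernsteinZelevinsky1976, §2.23] [cite: Zelevinsky1980, §1.1] -/
theorem finrank_weightSpace_eq_gkTwist (ζ : (Π a : Fin 3, GL {i : Fin 3 // (id : Fin 3 → Fin 3) i = a} F) → ℂ) :
    finrank ℂ ↥(⨅ m, Module.End.maxGenEigenspace (normalizedJacquetGL F (id : Fin 3 → Fin 3) r.ρ m) (ζ m)) =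
      finrank ℂ ↥(⨅ m, Module.End.maxGenEigenspace (normalizedJacquetGL F (id : Fin 3 → Fin 3) r'.ρ m)
        (ζ (leviProjection F (id : Fin 3 → Fin 3) ⟨gkAutomorphism (blockDiagonalGL F (id : Fin 3 → Fin 3) m),
          (K2E3GL3WeakCellLemmaTransport.gkAutomorphism_mem_borel_iff F _).2 (blockDiagonalGL_mem (id : Fin 3 → Fin 3) m)⟩))) :=
  finrank_weightSpace_eq_of_gkAutomorphism r.ρ r'.ρ Φ hΦ ζ

/-- **`mult_{r_B r′}(ζ) = mult_{r_B r}(ζ ∘ θ_T)`** (the symmetric form, `Φ⁻¹` is `θ`-equivariant too). [cite: BernsteinZelevinsky1976, §2.23] [cite: Zelevinsky1980, §1.1] -/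
theorem finrank_weightSpace_gkTwist_eq (ζ : (Π a : Fin 3, GL {i : Fin 3 // (id : Fin 3 → Fin 3) i = a} F) → ℂ) :
    finrank ℂ ↥(⨅ m, Module.End.maxGenEigenspace (normalizedJacquetGL F (id : Fin 3 → Fin 3) r'.ρ m) (ζ m)) =
      finrank ℂ ↥(⨅ m, Module.End.maxGenEigenspace (normalizedJacquetGL F (id : Fin 3 → Fin 3) r.ρ m)
        (ζ (leviProjection F (id : Fin 3 → Fin 3) ⟨gkAutomorphism (blockDiagonalGL F (id : Fin 3 → Fin 3) m),
          (K2E3GL3WeakCellLemmaTransport.gkAutomorphism_mem_borel_iff F _).2 (blockDiagonalGL_mem (id : Fin 3 → Fin 3) m)⟩))) :=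
  finrank_weightSpace_eq_of_gkAutomorphism r'.ρ r.ρ Φ.symm (symm_equivariant Φ hΦ) ζ

/-- **IN `tch` LETTERS: `mult_{r′}(tch θv) = mult_r(tch(θv₂⁻¹, θv₁⁻¹, θv₀⁻¹))`** (★ part 1 `tch_comp_leviAut_gkAutomorphism`; `tch θ t = ∏ₐ θₐ(det tₐ)`, the ★ H0 ∕ GEO-QB currency).
[cite: BernsteinZelevinsky1976, §2.23] [cite: Zelevinsky1980, §1.1] -/
theorem finrank_weightSpace_gkTwist_tch (θv : Fin 3 → (Fˣ →* ℂˣ)) :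
    finrank ℂ ↥(⨅ m, Module.End.maxGenEigenspace (normalizedJacquetGL F (id : Fin 3 → Fin 3) r'.ρ m)
        ((((∏ a : Fin 3, ((θv a).comp (Matrix.GeneralLinearGroup.det.comp (Pi.evalMonoidHom (fun a : Fin 3 => GL {i : Fin 3 // (id : Fin 3 → Fin 3) i = a} F) a)))) m : ℂˣ) : ℂ))) =
      finrank ℂ ↥(⨅ m, Module.End.maxGenEigenspace (normalizedJacquetGL F (id : Fin 3 → Fin 3) r.ρ m)
        ((((∏ a : Fin 3, ((![(θv 2)⁻¹, (θv 1)⁻¹, (θv 0)⁻¹] : Fin 3 → (Fˣ →* ℂˣ)) a).comp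
          (Matrix.GeneralLinearGroup.det.comp (Pi.evalMonoidHom (fun a : Fin 3 => GL {i : Fin 3 // (id : Fin 3 → Fin 3) i = a} F) a))) m : ℂˣ) : ℂ))) := by
  have h := finrank_weightSpace_gkTwist_eq Φ hΦ (fun m : (Π a : Fin 3, GL {i : Fin 3 // (id : Fin 3 → Fin 3) i = a} F) =>
    ((((∏ a : Fin 3, ((θv a).comp (Matrix.GeneralLinearGroup.det.comp (Pi.evalMonoidHom (fun a : Fin 3 => GL {i : Fin 3 // (id : Fin 3 → Fin 3) i = a} F) a)))) m : ℂˣ) : ℂ)))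
  have key := tch_comp_leviAut_gkAutomorphism (F := F) θv
  beta_reduce at h
  rw [h]
  exact congrArg (fun ξ : (Π a : Fin 3, GL {i : Fin 3 // (id : Fin 3 → Fin 3) i = a} F) → ℂ =>
    finrank ℂ ↥(⨅ m, Module.End.maxGenEigenspace (normalizedJacquetGL F (id : Fin 3 → Fin 3) r.ρ m) (ξ m))) key

/-- **`r_B r′` is finite-dimensional iff `r_B r` is** (`[v] ↦ [Φ v]` is a linear isomorphism of the Jacquet modules, ★ E4b-T `map_coinvariantsKer_eq`). [cite: BernsteinZelevinsky1976, §2.23] -/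
theorem finiteDimensional_jacquet_gkTwist_iff :
    FiniteDimensional ℂ (restrictUnipotentGL F (id : Fin 3 → Fin 3) r'.ρ).Coinvariants ↔ FiniteDimensional ℂ (restrictUnipotentGL F (id : Fin 3 → Fin 3) r.ρ).Coinvariants := by
  have hker := map_coinvariantsKer_eq F (id : Fin 3 → Fin 3) (id : Fin 3 → Fin 3)
    (gkAutomorphism : GL (Fin 3) F ≃ₜ* GL (Fin 3) F) (gkAutomorphism_gkAutomorphism F)
    (K2E3GL3WeakCellLemmaTransport.gkAutomorphism_mem_borel_iff F) (K2E3GL3WeakCellLemmaTransport.gkAutomorphism_mem_borel_iff F)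
    gkAutomorphism_mem_unipotentRadicalP_borel gkAutomorphism_mem_unipotentRadicalP_borel r.ρ r'.ρ Φ hΦ
  let L : (restrictUnipotentGL F (id : Fin 3 → Fin 3) r.ρ).Coinvariants ≃ₗ[ℂ] (restrictUnipotentGL F (id : Fin 3 → Fin 3) r'.ρ).Coinvariants :=
    Submodule.Quotient.equiv _ _ Φ hker
  constructor
  · intro h
    exact LinearEquiv.finiteDimensional L.symm
  · intro h
    exact LinearEquiv.finiteDimensional L

/-- **`r′` is admissible iff `r` is** (★ `IsAdmissible.of_equivariant_equiv`, `θ` a homeomorphism). [cite: BernsteinZelevinsky1976, §2.21] -/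
theorem isAdmissible_gkTwist_iff : r'.ρ.IsAdmissible ↔ r.ρ.IsAdmissible := by
  haveI : IsTopologicalRing F := inferInstance
  constructor
  · intro h
    exact IsAdmissible.of_equivariant_equiv (gkAutomorphism : GL (Fin 3) F ≃ₜ* GL (Fin 3) F).toMulEquiv Φ.symm (symm_equivariant Φ hΦ)
      (gkAutomorphism : GL (Fin 3) F ≃ₜ* GL (Fin 3) F).continuous (gkAutomorphism : GL (Fin 3) F ≃ₜ* GL (Fin 3) F).symm.continuous h
  · intro h
    exact IsAdmissible.of_equivariant_equiv (gkAutomorphism : GL (Fin 3) F ≃ₜ* GL (Fin 3) F).toMulEquiv Φ hΦ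
      (gkAutomorphism : GL (Fin 3) F ≃ₜ* GL (Fin 3) F).continuous (gkAutomorphism : GL (Fin 3) F ≃ₜ* GL (Fin 3) F).symm.continuous h

end Twist

end Summit.HodgeConjecture.HodgeConjecture.Cruxes.H413.K2E3GL3IrrepTransport

end
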